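import Summits.MatrixMultiplication.MatrixMultiplication.Theorems.SubgroupIdentityDesigns.Negative.FieldFrobenius

/-!
# Singer–Frobenius split with a FROBENIUS POWER (cell B2b-5 `b2b-lgcu-borel`, gen 21)

VALUE = THEOREM on the level-one slice of `SubgroupIdentityDesigns` — NOT summit progress; the crux
(`stmt-MatrixMultiplication-14079`) is untouched.

`FieldFrobenius.lean` excludes level-one TPP identity designs whenever one member contains the image
`μ(N')` of a subgroup `N' ≤ Fˣ` containing all `(p-1)`-th powers (`F` a finite field with an
`𝔽_p`-basis `b` of size `m`, `μ` = multiplication in coordinates) and ANOTHER member contains the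
full Frobenius `Φ` (`x ↦ x^p` in coordinates).  This file replaces `Φ` by ANY NON-TRIVIAL POWER
`Φ^d` (non-trivial meaning `x^{p^d} ≠ x` for some `x ∈ F`, i.e. `m ∤ d`): the cyclic-index
functional of `SplitFunctional.lean` only needs (i) `μ_y Φ^{di} = 1 ⇒ Φ^{di} = 1`, (ii) the
TRANSLATED ACTION `Φ^{di} u = μ_{x^{p^{di}-1}} u` with `x^{p^{di}-1} ∈ N'` (a `(p-1)`-th power
power), (iii) `Φ^{-di} μ(N') Φ^{di} = μ(N')` — all of which `FieldFrobenius` proves for every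
exponent.  Hence: `μ(N')` in one member and `Φ^d ≠ 1` in another ⇒ no level-one design, for all
`p`, `m`, `ε` and all six orderings.

New verdicts covered (GAP, kit j146070, `(m,p) = (4,3)`): `N_b ⋊ ⟨Φ²⟩` and `S ⋊ ⟨Φ²⟩` are
non-carriers although `⟨Φ²⟩` has order `2 < m`; in general every intermediate group
`μ(N') ⋊ ⟨Φ^d⟩` (`d | m`, `d < m`) of `ΓL₁(p^m) ∩ GL_m(𝔽_p)` is excluded as soon as its two factors
sit in different members — and also when BOTH sit in the same member `H_a`: the cover
hypothesis of the functional (`n Φ^{di} ∈ H₁ H₂ H₃`) is then met with the other two factors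
trivial, so `μ(N') ≤ H_a ∧ Φ^d ∈ H_a` ⇒ no level-one design as well (`₁₁`, `₂₂`, `₃₃` below; this is
the character-free form of "`μ(N') ⋊ ⟨Φ^d⟩` is a linearly detected non-carrier", matching the GAP
verdicts for `N_b ⋊ ⟨Φ⟩`, `ΓL₁` in ORACLE-g21 §G21-17).  Honest scope: `μ(N')` ALONE and `⟨Φ^d⟩`
alone are carriers (semiregular, resp. too small to matter), so some member must meet both factors'
roles as stated; nothing is claimed when `N'` fails to contain the `(p-1)`-th powers.  The final
`no_design_of_factored` lets the Singer part be SPLIT over all three members (`z^{p-1} ∈ N₁'N₂'N₃'`,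
`μ(Nₖ') ≤ Hₖ`, `Φ^d` in any member) and subsumes the twelve ordered corollaries; the primed
version `no_design_of_factored'` sharpens the Singer part to the `(p^d-1)`-th powers (for `Φ^d` the
translated action needs only `x^{p^{di}-1}`, a `(p^d-1)`-th power power).
-/

open scoped BigOperators Classical Matrix

namespace Summit.MatrixMultiplication.MatrixMultiplication.Theorems.SubgroupIdentityDesigns.Negative
namespace FrobeniusPower

open Summit.MatrixMultiplication.MatrixMultiplication.Theorems.LieRankDesigns.Negative (GLm Mat)
open SplitFunctional (no_design_of_split conj_pow_mem)
open FieldFrobenius (mulGL frobGL frobMat mulGL_mulVec frobMat_pow_mulVec coe_frobGL_pow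
  frob_translated frob_inv_conj_mem)

variable {p m : ℕ} [hp : Fact p.Prime]
variable {F : Type*} [Field F] [Fintype F] [Algebra (ZMod p) F]
variable (b : Module.Basis (Fin m) (ZMod p) F)

/-- `(Φ^d)^i = Φ^{d i}` as matrices. -/
theorem coe_frobGL_pow_pow (hm : m ≠ 0) (d i : ℕ) :
    (((frobGL b hm ^ d) ^ i : GLm p m) : Mat p m) = frobMat b ^ (d * i) := by
  rw [← pow_mul, coe_frobGL_pow]

/-- `Φ^d ≠ 1` as soon as `x^{p^d} ≠ x` for some `x`; then the order of `Φ^d` is at least `2`. -/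
theorem two_le_orderOf_frobGL_pow (hm : m ≠ 0) (d : ℕ) (hF : ∃ x : F, x ^ p ^ d ≠ x) :
    2 ≤ orderOf (frobGL b hm ^ d) := by
  obtain ⟨x, hx⟩ := hF
  have hne : frobGL b hm ^ d ≠ 1 := by
    intro h1
    apply hx
    have h := frobMat_pow_mulVec b d x
    rw [← coe_frobGL_pow b hm, h1] at h
    simp only [Units.val_one, Matrix.one_mulVec] at h
    exact (b.repr.injective (DFunLike.coe_injective h)).symm
  have hpos : 0 < orderOf (frobGL b hm ^ d) := orderOf_pos _
  have hne1 : orderOf (frobGL b hm ^ d) ≠ 1 := by rwa [Ne, orderOf_eq_one_iff]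
  omega

/-- `μ_y (Φ^d)^i = 1` forces `(Φ^d)^i = 1` (evaluate at `1 ∈ F`), hence `i = 0` below the order. -/
theorem mul_frobPow_pow_eq_one (hm : m ≠ 0) (d : ℕ) {N' : Subgroup Fˣ} :
    ∀ n ∈ N'.map (mulGL b), ∀ i < orderOf (frobGL b hm ^ d),
      (n : GLm p m) * (frobGL b hm ^ d) ^ i = 1 → i = 0 := by
  intro n hn i hi heq
  obtain ⟨y, -, rfl⟩ := Subgroup.mem_map.mp hn
  have h1 : ((mulGL b y * (frobGL b hm ^ d) ^ i : GLm p m) : Mat p m) *ᵥ ⇑(b.repr (1 : F)) =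
      ⇑(b.repr (1 : F)) := by rw [heq]; simp
  rw [Units.val_mul, ← Matrix.mulVec_mulVec, coe_frobGL_pow_pow, frobMat_pow_mulVec, one_pow,
    mulGL_mulVec, mul_one] at h1
  have hy : (y : F) = 1 := b.repr.injective (DFunLike.coe_injective h1)
  have hy1 : y = 1 := Units.ext hy
  rw [hy1, map_one, one_mul] at heq
  exact Nat.eq_zero_of_dvd_of_lt (orderOf_dvd_of_pow_eq_one heq) hi

/-- TRANSLATED ACTION for `Φ^d`: `(Φ^d)^i u = μ_y u` for some `y ∈ N'`. -/
theorem frobPow_translated (hm : m ≠ 0) (d : ℕ) {N' : Subgroup Fˣ}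
    (hN' : ∀ z : Fˣ, z ^ (p - 1) ∈ N') (i : ℕ) (u : Fin m → ZMod p) : ∃ n ∈ N'.map (mulGL b),
      (((frobGL b hm ^ d) ^ i : GLm p m) : Mat p m) *ᵥ u = ((n : GLm p m) : Mat p m) *ᵥ u := by
  rw [← pow_mul]
  exact frob_translated b hm hN' (d * i) u

/-- `Φ^d` normalises `μ(N')`: `(Φ^d)⁻¹ n Φ^d ∈ μ(N')`. -/
theorem frobPow_inv_conj_mem (hm : m ≠ 0) (d : ℕ) (N' : Subgroup Fˣ) :
    ∀ n ∈ N'.map (mulGL b), (frobGL b hm ^ d)⁻¹ * n * frobGL b hm ^ d ∈ N'.map (mulGL b) :=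
  fun _ hn => conj_pow_mem (frob_inv_conj_mem b hm N') hn d

/-! ## The exclusions -/

variable {H₁ H₂ H₃ : Subgroup (GLm p m)}

/-- Shared core: any cover of the `μ_y (Φ^d)^i ≠ 1` (`y ∈ N'`) by `H₁ H₂ H₃` excludes a design. -/
theorem no_design_of_cover (hm : m ≠ 0) (d : ℕ) (hF : ∃ x : F, x ^ p ^ d ≠ x) {N' : Subgroup Fˣ}
    (hN' : ∀ z : Fˣ, z ^ (p - 1) ∈ N')
    (hcov : ∀ n ∈ N'.map (mulGL b), ∀ i < orderOf (frobGL b hm ^ d),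
      (n : GLm p m) * (frobGL b hm ^ d) ^ i ≠ 1 →
        ∃ a ∈ H₁, ∃ b' ∈ H₂, ∃ c ∈ H₃, a * b' * c = n * (frobGL b hm ^ d) ^ i) :
    ¬ ∃ c : Mat p m → ℂ, (∀ M, 1 < M.rank → c M = 0) ∧
      (∑ M, c M * ZMod.stdAddChar (Matrix.trace (M * ((1 : GLm p m) : Mat p m)))) = 1 ∧
      ∀ a ∈ H₁, ∀ b ∈ H₂, ∀ g ∈ H₃, a * b * g ≠ 1 →
        (∑ M, c M * ZMod.stdAddChar (Matrix.trace (M * ((a * b * g : GLm p m) : Mat p m)))) = 0 :=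
  no_design_of_split (N'.map (mulGL b)) (frobGL b hm ^ d) (two_le_orderOf_frobGL_pow b hm d hF)
    (mul_frobPow_pow_eq_one b hm d) (fun i _ u => frobPow_translated b hm d hN' i u) hcov

/-- **FROBENIUS-POWER SPLIT `(1,2)`**: `μ(N') ≤ H₁`, `Φ^d ∈ H₂` (`Φ^d ≠ 1`) ⇒ no level-one design. -/
theorem no_design_of_singerFrobPow₁₂ (hm : m ≠ 0) {d : ℕ} (hF : ∃ x : F, x ^ p ^ d ≠ x)
    {N' : Subgroup Fˣ} (hN' : ∀ z : Fˣ, z ^ (p - 1) ∈ N')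
    (h₁ : ∀ z ∈ N', mulGL b z ∈ H₁) (h₂ : frobGL b hm ^ d ∈ H₂) :
    ¬ ∃ c : Mat p m → ℂ, (∀ M, 1 < M.rank → c M = 0) ∧
      (∑ M, c M * ZMod.stdAddChar (Matrix.trace (M * ((1 : GLm p m) : Mat p m)))) = 1 ∧
      ∀ a ∈ H₁, ∀ b ∈ H₂, ∀ g ∈ H₃, a * b * g ≠ 1 →
        (∑ M, c M * ZMod.stdAddChar (Matrix.trace (M * ((a * b * g : GLm p m) : Mat p m)))) = 0 := by
  refine no_design_of_cover b hm d hF hN' fun n hn i _ _ => ?_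
  obtain ⟨y, hy, rfl⟩ := Subgroup.mem_map.mp hn
  exact ⟨_, h₁ y hy, _, H₂.pow_mem h₂ i, 1, H₃.one_mem, mul_one _⟩

/-- **`(1,3)`**: `μ(N') ≤ H₁`, `Φ^d ∈ H₃`. -/
theorem no_design_of_singerFrobPow₁₃ (hm : m ≠ 0) {d : ℕ} (hF : ∃ x : F, x ^ p ^ d ≠ x)
    {N' : Subgroup Fˣ} (hN' : ∀ z : Fˣ, z ^ (p - 1) ∈ N')
    (h₁ : ∀ z ∈ N', mulGL b z ∈ H₁) (h₃ : frobGL b hm ^ d ∈ H₃) :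
    ¬ ∃ c : Mat p m → ℂ, (∀ M, 1 < M.rank → c M = 0) ∧
      (∑ M, c M * ZMod.stdAddChar (Matrix.trace (M * ((1 : GLm p m) : Mat p m)))) = 1 ∧
      ∀ a ∈ H₁, ∀ b ∈ H₂, ∀ g ∈ H₃, a * b * g ≠ 1 →
        (∑ M, c M * ZMod.stdAddChar (Matrix.trace (M * ((a * b * g : GLm p m) : Mat p m)))) = 0 := by
  refine no_design_of_cover b hm d hF hN' fun n hn i _ _ => ?_
  obtain ⟨y, hy, rfl⟩ := Subgroup.mem_map.mp hn
  exact ⟨_, h₁ y hy, 1, H₂.one_mem, _, H₃.pow_mem h₃ i, by rw [mul_one]⟩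

/-- **`(2,3)`**: `μ(N') ≤ H₂`, `Φ^d ∈ H₃`. -/
theorem no_design_of_singerFrobPow₂₃ (hm : m ≠ 0) {d : ℕ} (hF : ∃ x : F, x ^ p ^ d ≠ x)
    {N' : Subgroup Fˣ} (hN' : ∀ z : Fˣ, z ^ (p - 1) ∈ N')
    (h₂ : ∀ z ∈ N', mulGL b z ∈ H₂) (h₃ : frobGL b hm ^ d ∈ H₃) :
    ¬ ∃ c : Mat p m → ℂ, (∀ M, 1 < M.rank → c M = 0) ∧
      (∑ M, c M * ZMod.stdAddChar (Matrix.trace (M * ((1 : GLm p m) : Mat p m)))) = 1 ∧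
      ∀ a ∈ H₁, ∀ b ∈ H₂, ∀ g ∈ H₃, a * b * g ≠ 1 →
        (∑ M, c M * ZMod.stdAddChar (Matrix.trace (M * ((a * b * g : GLm p m) : Mat p m)))) = 0 := by
  refine no_design_of_cover b hm d hF hN' fun n hn i _ _ => ?_
  obtain ⟨y, hy, rfl⟩ := Subgroup.mem_map.mp hn
  exact ⟨1, H₁.one_mem, _, h₂ y hy, _, H₃.pow_mem h₃ i, by rw [one_mul]⟩

/-- **`(2,1)`**: `Φ^d ∈ H₁`, `μ(N') ≤ H₂` (reorder `n q^i = q^i · q^{-i} n q^i`). -/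
theorem no_design_of_singerFrobPow₂₁ (hm : m ≠ 0) {d : ℕ} (hF : ∃ x : F, x ^ p ^ d ≠ x)
    {N' : Subgroup Fˣ} (hN' : ∀ z : Fˣ, z ^ (p - 1) ∈ N')
    (h₁ : frobGL b hm ^ d ∈ H₁) (h₂ : ∀ z ∈ N', mulGL b z ∈ H₂) :
    ¬ ∃ c : Mat p m → ℂ, (∀ M, 1 < M.rank → c M = 0) ∧
      (∑ M, c M * ZMod.stdAddChar (Matrix.trace (M * ((1 : GLm p m) : Mat p m)))) = 1 ∧
      ∀ a ∈ H₁, ∀ b ∈ H₂, ∀ g ∈ H₃, a * b * g ≠ 1 →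
        (∑ M, c M * ZMod.stdAddChar (Matrix.trace (M * ((a * b * g : GLm p m) : Mat p m)))) = 0 := by
  have hle : N'.map (mulGL b) ≤ H₂ := Subgroup.map_le_iff_le_comap.mpr fun z hz => h₂ z hz
  refine no_design_of_cover b hm d hF hN' fun n hn i _ _ => ?_
  exact ⟨_, H₁.pow_mem h₁ i, _, hle (conj_pow_mem (frobPow_inv_conj_mem b hm d N') hn i), 1,
    H₃.one_mem, by group⟩

/-- **`(3,1)`**: `Φ^d ∈ H₁`, `μ(N') ≤ H₃`. -/
theorem no_design_of_singerFrobPow₃₁ (hm : m ≠ 0) {d : ℕ} (hF : ∃ x : F, x ^ p ^ d ≠ x)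
    {N' : Subgroup Fˣ} (hN' : ∀ z : Fˣ, z ^ (p - 1) ∈ N')
    (h₁ : frobGL b hm ^ d ∈ H₁) (h₃ : ∀ z ∈ N', mulGL b z ∈ H₃) :
    ¬ ∃ c : Mat p m → ℂ, (∀ M, 1 < M.rank → c M = 0) ∧
      (∑ M, c M * ZMod.stdAddChar (Matrix.trace (M * ((1 : GLm p m) : Mat p m)))) = 1 ∧
      ∀ a ∈ H₁, ∀ b ∈ H₂, ∀ g ∈ H₃, a * b * g ≠ 1 →
        (∑ M, c M * ZMod.stdAddChar (Matrix.trace (M * ((a * b * g : GLm p m) : Mat p m)))) = 0 := by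
  have hle : N'.map (mulGL b) ≤ H₃ := Subgroup.map_le_iff_le_comap.mpr fun z hz => h₃ z hz
  refine no_design_of_cover b hm d hF hN' fun n hn i _ _ => ?_
  exact ⟨_, H₁.pow_mem h₁ i, 1, H₂.one_mem, _,
    hle (conj_pow_mem (frobPow_inv_conj_mem b hm d N') hn i), by group⟩

/-- **`(3,2)`**: `Φ^d ∈ H₂`, `μ(N') ≤ H₃`. -/
theorem no_design_of_singerFrobPow₃₂ (hm : m ≠ 0) {d : ℕ} (hF : ∃ x : F, x ^ p ^ d ≠ x)
    {N' : Subgroup Fˣ} (hN' : ∀ z : Fˣ, z ^ (p - 1) ∈ N')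
    (h₂ : frobGL b hm ^ d ∈ H₂) (h₃ : ∀ z ∈ N', mulGL b z ∈ H₃) :
    ¬ ∃ c : Mat p m → ℂ, (∀ M, 1 < M.rank → c M = 0) ∧
      (∑ M, c M * ZMod.stdAddChar (Matrix.trace (M * ((1 : GLm p m) : Mat p m)))) = 1 ∧
      ∀ a ∈ H₁, ∀ b ∈ H₂, ∀ g ∈ H₃, a * b * g ≠ 1 →
        (∑ M, c M * ZMod.stdAddChar (Matrix.trace (M * ((a * b * g : GLm p m) : Mat p m)))) = 0 := by
  have hle : N'.map (mulGL b) ≤ H₃ := Subgroup.map_le_iff_le_comap.mpr fun z hz => h₃ z hz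
  refine no_design_of_cover b hm d hF hN' fun n hn i _ _ => ?_
  exact ⟨1, H₁.one_mem, _, H₂.pow_mem h₂ i, _,
    hle (conj_pow_mem (frobPow_inv_conj_mem b hm d N') hn i), by group⟩

/-- **SAME MEMBER `(1,1)`**: `μ(N') ≤ H₁` and `Φ^d ∈ H₁` (`Φ^d ≠ 1`) ⇒ no level-one design. -/
theorem no_design_of_singerFrobPow₁₁ (hm : m ≠ 0) {d : ℕ} (hF : ∃ x : F, x ^ p ^ d ≠ x)
    {N' : Subgroup Fˣ} (hN' : ∀ z : Fˣ, z ^ (p - 1) ∈ N')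
    (h₁ : ∀ z ∈ N', mulGL b z ∈ H₁) (h₁' : frobGL b hm ^ d ∈ H₁) :
    ¬ ∃ c : Mat p m → ℂ, (∀ M, 1 < M.rank → c M = 0) ∧
      (∑ M, c M * ZMod.stdAddChar (Matrix.trace (M * ((1 : GLm p m) : Mat p m)))) = 1 ∧
      ∀ a ∈ H₁, ∀ b ∈ H₂, ∀ g ∈ H₃, a * b * g ≠ 1 →
        (∑ M, c M * ZMod.stdAddChar (Matrix.trace (M * ((a * b * g : GLm p m) : Mat p m)))) = 0 := by
  refine no_design_of_cover b hm d hF hN' fun n hn i _ _ => ?_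
  obtain ⟨y, hy, rfl⟩ := Subgroup.mem_map.mp hn
  exact ⟨_, H₁.mul_mem (h₁ y hy) (H₁.pow_mem h₁' i), 1, H₂.one_mem, 1, H₃.one_mem,
    by rw [mul_one, mul_one]⟩

/-- **SAME MEMBER `(2,2)`**: `μ(N') ≤ H₂` and `Φ^d ∈ H₂`. -/
theorem no_design_of_singerFrobPow₂₂ (hm : m ≠ 0) {d : ℕ} (hF : ∃ x : F, x ^ p ^ d ≠ x)
    {N' : Subgroup Fˣ} (hN' : ∀ z : Fˣ, z ^ (p - 1) ∈ N')
    (h₂ : ∀ z ∈ N', mulGL b z ∈ H₂) (h₂' : frobGL b hm ^ d ∈ H₂) :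
    ¬ ∃ c : Mat p m → ℂ, (∀ M, 1 < M.rank → c M = 0) ∧
      (∑ M, c M * ZMod.stdAddChar (Matrix.trace (M * ((1 : GLm p m) : Mat p m)))) = 1 ∧
      ∀ a ∈ H₁, ∀ b ∈ H₂, ∀ g ∈ H₃, a * b * g ≠ 1 →
        (∑ M, c M * ZMod.stdAddChar (Matrix.trace (M * ((a * b * g : GLm p m) : Mat p m)))) = 0 := by
  refine no_design_of_cover b hm d hF hN' fun n hn i _ _ => ?_
  obtain ⟨y, hy, rfl⟩ := Subgroup.mem_map.mp hn
  exact ⟨1, H₁.one_mem, _, H₂.mul_mem (h₂ y hy) (H₂.pow_mem h₂' i), 1, H₃.one_mem,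
    by rw [one_mul, mul_one]⟩

/-- **SAME MEMBER `(3,3)`**: `μ(N') ≤ H₃` and `Φ^d ∈ H₃`. -/
theorem no_design_of_singerFrobPow₃₃ (hm : m ≠ 0) {d : ℕ} (hF : ∃ x : F, x ^ p ^ d ≠ x)
    {N' : Subgroup Fˣ} (hN' : ∀ z : Fˣ, z ^ (p - 1) ∈ N')
    (h₃ : ∀ z ∈ N', mulGL b z ∈ H₃) (h₃' : frobGL b hm ^ d ∈ H₃) :
    ¬ ∃ c : Mat p m → ℂ, (∀ M, 1 < M.rank → c M = 0) ∧
      (∑ M, c M * ZMod.stdAddChar (Matrix.trace (M * ((1 : GLm p m) : Mat p m)))) = 1 ∧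
      ∀ a ∈ H₁, ∀ b ∈ H₂, ∀ g ∈ H₃, a * b * g ≠ 1 →
        (∑ M, c M * ZMod.stdAddChar (Matrix.trace (M * ((a * b * g : GLm p m) : Mat p m)))) = 0 := by
  refine no_design_of_cover b hm d hF hN' fun n hn i _ _ => ?_
  obtain ⟨y, hy, rfl⟩ := Subgroup.mem_map.mp hn
  exact ⟨1, H₁.one_mem, 1, H₂.one_mem, _, H₃.mul_mem (h₃ y hy) (H₃.pow_mem h₃' i),
    by rw [one_mul, one_mul]⟩

/-- **FACTORED `ΓL₁` EXCLUSION** (subsumes the twelve corollaries above): if subgroups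
`N₁', N₂', N₃' ≤ Fˣ` with `μ(Nₖ') ≤ Hₖ` JOINTLY contain the `(p-1)`-th powers
(`z^{p-1} ∈ N₁' N₂' N₃'` for all `z`) and some member contains a non-trivial Frobenius power `Φ^d`,
then `(H₁, H₂, H₃)` carries no level-one identity design.  (The Singer part may thus be split over
all three members — e.g. `N_b = C₇ × C₁₉` at `(m,p) = (3,11)` with `C₇ ≤ H₁`, `C₁₉ ≤ H₂`, `Φ ∈ H₃`;
cover: `μ_{y₁} μ_{y₂} μ_{y₃} Φ^{di}` is regrouped with `Φ^{-di} μ(Nₖ') Φ^{di} = μ(Nₖ')`.) -/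
theorem no_design_of_factored (hm : m ≠ 0) {d : ℕ} (hF : ∃ x : F, x ^ p ^ d ≠ x)
    {N₁' N₂' N₃' : Subgroup Fˣ} (hN' : ∀ z : Fˣ, z ^ (p - 1) ∈ N₁' ⊔ N₂' ⊔ N₃')
    (h₁ : ∀ z ∈ N₁', mulGL b z ∈ H₁) (h₂ : ∀ z ∈ N₂', mulGL b z ∈ H₂)
    (h₃ : ∀ z ∈ N₃', mulGL b z ∈ H₃)
    (hΦ : frobGL b hm ^ d ∈ H₁ ∨ frobGL b hm ^ d ∈ H₂ ∨ frobGL b hm ^ d ∈ H₃) :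
    ¬ ∃ c : Mat p m → ℂ, (∀ M, 1 < M.rank → c M = 0) ∧
      (∑ M, c M * ZMod.stdAddChar (Matrix.trace (M * ((1 : GLm p m) : Mat p m)))) = 1 ∧
      ∀ a ∈ H₁, ∀ b ∈ H₂, ∀ g ∈ H₃, a * b * g ≠ 1 →
        (∑ M, c M * ZMod.stdAddChar (Matrix.trace (M * ((a * b * g : GLm p m) : Mat p m)))) = 0 := by
  have hle₂ : N₂'.map (mulGL b) ≤ H₂ := Subgroup.map_le_iff_le_comap.mpr fun z hz => h₂ z hz
  have hle₃ : N₃'.map (mulGL b) ≤ H₃ := Subgroup.map_le_iff_le_comap.mpr fun z hz => h₃ z hz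
  have hcj : ∀ (N' : Subgroup Fˣ) {n : GLm p m}, n ∈ N'.map (mulGL b) → ∀ i : ℕ,
      ((frobGL b hm ^ d) ^ i)⁻¹ * n * (frobGL b hm ^ d) ^ i ∈ N'.map (mulGL b) :=
    fun N' _ hn i => conj_pow_mem (frobPow_inv_conj_mem b hm d N') hn i
  refine no_design_of_cover b hm d hF hN' fun n hn i _ _ => ?_
  obtain ⟨y, hy, rfl⟩ := Subgroup.mem_map.mp hn
  obtain ⟨y₁₂, hy₁₂, y₃, hy₃, rfl⟩ := Subgroup.mem_sup.mp hy
  obtain ⟨y₁, hy₁, y₂, hy₂, rfl⟩ := Subgroup.mem_sup.mp hy₁₂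
  have m₂ : mulGL b y₂ ∈ N₂'.map (mulGL b) := Subgroup.mem_map_of_mem _ hy₂
  have m₃ : mulGL b y₃ ∈ N₃'.map (mulGL b) := Subgroup.mem_map_of_mem _ hy₃
  rw [map_mul, map_mul]
  rcases hΦ with hq | hq | hq
  · exact ⟨mulGL b y₁ * (frobGL b hm ^ d) ^ i, H₁.mul_mem (h₁ _ hy₁) (H₁.pow_mem hq i),
      _, hle₂ (hcj N₂' m₂ i), _, hle₃ (hcj N₃' m₃ i), by group⟩
  · exact ⟨mulGL b y₁, h₁ _ hy₁,
      mulGL b y₂ * (frobGL b hm ^ d) ^ i, H₂.mul_mem (h₂ _ hy₂) (H₂.pow_mem hq i),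
      _, hle₃ (hcj N₃' m₃ i), by group⟩
  · exact ⟨mulGL b y₁, h₁ _ hy₁, mulGL b y₂, h₂ _ hy₂,
      mulGL b y₃ * (frobGL b hm ^ d) ^ i, H₃.mul_mem (h₃ _ hy₃) (H₃.pow_mem hq i), by group⟩

/-! ## Sharper Singer part for `Φ^d`: `(p^d - 1)`-th powers suffice

For `q = Φ^d` the translated action only needs `x^{p^{di}-1} ∈ N'`, and `p^{di}-1` is a multiple of
`p^d-1`; so the Singer part may be as small as the `(p^d-1)`-th powers (index `p^d-1` in `Fˣ`
instead of `p-1`).  Example `(m,p,d) = (4,3,2)`: `Fˣ = C₈₀`, eighth powers `= C₁₀`; `μ(C₁₀)` in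
one member and `Φ²` in another already exclude a design. -/

omit [Fintype F] [Algebra (ZMod p) F] in
/-- `z^{a-1} ∈ N'` for all `z` ⇒ `z^{a^i-1} ∈ N'` (`a^i - 1 = (a-1)(1 + a + ⋯ + a^{i-1})`, `a ≥ 1`). -/
theorem pow_pow_sub_one_mem' {a : ℕ} (ha : 1 ≤ a) {N' : Subgroup Fˣ}
    (hN' : ∀ z : Fˣ, z ^ (a - 1) ∈ N') (z : Fˣ) (i : ℕ) : z ^ (a ^ i - 1) ∈ N' := by
  have h := geom_sum_mul_add (a - 1) i
  rw [Nat.sub_add_cancel ha] at h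
  have he : a ^ i - 1 = (a - 1) * ∑ j ∈ Finset.range i, a ^ j := by
    rw [mul_comm]; omega
  rw [he, pow_mul]
  exact N'.pow_mem (hN' z) _

/-- TRANSLATED ACTION for `Φ^d` from `(p^d-1)`-th powers only. -/
theorem frobPow_translated' (hm : m ≠ 0) (d : ℕ) {N' : Subgroup Fˣ}
    (hN' : ∀ z : Fˣ, z ^ (p ^ d - 1) ∈ N') (i : ℕ) (u : Fin m → ZMod p) : ∃ n ∈ N'.map (mulGL b),
      (((frobGL b hm ^ d) ^ i : GLm p m) : Mat p m) *ᵥ u = ((n : GLm p m) : Mat p m) *ᵥ u := by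
  set x : F := b.equivFun.symm u with hx_def
  have hu : u = ⇑(b.repr x) := (FieldFrobenius.repr_symm b u).symm
  by_cases hx : x = 0
  · refine ⟨1, Subgroup.one_mem _, ?_⟩
    have hu0 : u = 0 := by rw [hu, hx, map_zero]; rfl
    simp [hu0]
  · set z : Fˣ := Units.mk0 x hx with hz_def
    refine ⟨mulGL b (z ^ ((p ^ d) ^ i - 1)),
      Subgroup.mem_map_of_mem _ (pow_pow_sub_one_mem' (Nat.one_le_pow _ _ hp.out.pos) hN' z i), ?_⟩
    rw [hu, coe_frobGL_pow_pow, frobMat_pow_mulVec, mulGL_mulVec, pow_mul]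
    congr 2
    rw [Units.val_pow_eq_pow_val, Units.val_mk0,
      pow_sub_one_mul (pow_ne_zero i (pow_ne_zero d hp.out.ne_zero))]

/-- Core with the sharper Singer part. -/
theorem no_design_of_cover' (hm : m ≠ 0) (d : ℕ) (hF : ∃ x : F, x ^ p ^ d ≠ x) {N' : Subgroup Fˣ}
    (hN' : ∀ z : Fˣ, z ^ (p ^ d - 1) ∈ N')
    (hcov : ∀ n ∈ N'.map (mulGL b), ∀ i < orderOf (frobGL b hm ^ d),
      (n : GLm p m) * (frobGL b hm ^ d) ^ i ≠ 1 →
        ∃ a ∈ H₁, ∃ b' ∈ H₂, ∃ c ∈ H₃, a * b' * c = n * (frobGL b hm ^ d) ^ i) :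
    ¬ ∃ c : Mat p m → ℂ, (∀ M, 1 < M.rank → c M = 0) ∧
      (∑ M, c M * ZMod.stdAddChar (Matrix.trace (M * ((1 : GLm p m) : Mat p m)))) = 1 ∧
      ∀ a ∈ H₁, ∀ b ∈ H₂, ∀ g ∈ H₃, a * b * g ≠ 1 →
        (∑ M, c M * ZMod.stdAddChar (Matrix.trace (M * ((a * b * g : GLm p m) : Mat p m)))) = 0 :=
  no_design_of_split (N'.map (mulGL b)) (frobGL b hm ^ d) (two_le_orderOf_frobGL_pow b hm d hF)
    (mul_frobPow_pow_eq_one b hm d) (fun i _ u => frobPow_translated' b hm d hN' i u) hcov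

/-- **FACTORED `ΓL₁` EXCLUSION, SHARP SINGER PART**: as `no_design_of_factored`, but the three
pieces need only contain the `(p^d-1)`-th powers jointly (`z^{p^d-1} ∈ N₁' N₂' N₃'`). -/
theorem no_design_of_factored' (hm : m ≠ 0) {d : ℕ} (hF : ∃ x : F, x ^ p ^ d ≠ x)
    {N₁' N₂' N₃' : Subgroup Fˣ} (hN' : ∀ z : Fˣ, z ^ (p ^ d - 1) ∈ N₁' ⊔ N₂' ⊔ N₃')
    (h₁ : ∀ z ∈ N₁', mulGL b z ∈ H₁) (h₂ : ∀ z ∈ N₂', mulGL b z ∈ H₂)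
    (h₃ : ∀ z ∈ N₃', mulGL b z ∈ H₃)
    (hΦ : frobGL b hm ^ d ∈ H₁ ∨ frobGL b hm ^ d ∈ H₂ ∨ frobGL b hm ^ d ∈ H₃) :
    ¬ ∃ c : Mat p m → ℂ, (∀ M, 1 < M.rank → c M = 0) ∧
      (∑ M, c M * ZMod.stdAddChar (Matrix.trace (M * ((1 : GLm p m) : Mat p m)))) = 1 ∧
      ∀ a ∈ H₁, ∀ b ∈ H₂, ∀ g ∈ H₃, a * b * g ≠ 1 →
        (∑ M, c M * ZMod.stdAddChar (Matrix.trace (M * ((a * b * g : GLm p m) : Mat p m)))) = 0 := by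
  have hle₂ : N₂'.map (mulGL b) ≤ H₂ := Subgroup.map_le_iff_le_comap.mpr fun z hz => h₂ z hz
  have hle₃ : N₃'.map (mulGL b) ≤ H₃ := Subgroup.map_le_iff_le_comap.mpr fun z hz => h₃ z hz
  have hcj : ∀ (N' : Subgroup Fˣ) {n : GLm p m}, n ∈ N'.map (mulGL b) → ∀ i : ℕ,
      ((frobGL b hm ^ d) ^ i)⁻¹ * n * (frobGL b hm ^ d) ^ i ∈ N'.map (mulGL b) :=
    fun N' _ hn i => conj_pow_mem (frobPow_inv_conj_mem b hm d N') hn i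
  refine no_design_of_cover' b hm d hF hN' fun n hn i _ _ => ?_
  obtain ⟨y, hy, rfl⟩ := Subgroup.mem_map.mp hn
  obtain ⟨y₁₂, hy₁₂, y₃, hy₃, rfl⟩ := Subgroup.mem_sup.mp hy
  obtain ⟨y₁, hy₁, y₂, hy₂, rfl⟩ := Subgroup.mem_sup.mp hy₁₂
  have m₂ : mulGL b y₂ ∈ N₂'.map (mulGL b) := Subgroup.mem_map_of_mem _ hy₂
  have m₃ : mulGL b y₃ ∈ N₃'.map (mulGL b) := Subgroup.mem_map_of_mem _ hy₃
  rw [map_mul, map_mul]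
  rcases hΦ with hq | hq | hq
  · exact ⟨mulGL b y₁ * (frobGL b hm ^ d) ^ i, H₁.mul_mem (h₁ _ hy₁) (H₁.pow_mem hq i),
      _, hle₂ (hcj N₂' m₂ i), _, hle₃ (hcj N₃' m₃ i), by group⟩
  · exact ⟨mulGL b y₁, h₁ _ hy₁,
      mulGL b y₂ * (frobGL b hm ^ d) ^ i, H₂.mul_mem (h₂ _ hy₂) (H₂.pow_mem hq i),
      _, hle₃ (hcj N₃' m₃ i), by group⟩
  · exact ⟨mulGL b y₁, h₁ _ hy₁, mulGL b y₂, h₂ _ hy₂,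
      mulGL b y₃ * (frobGL b hm ^ d) ^ i, H₃.mul_mem (h₃ _ hy₃) (H₃.pow_mem hq i), by group⟩

end FrobeniusPower
end Summit.MatrixMultiplication.MatrixMultiplication.Theorems.SubgroupIdentityDesigns.Negative
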